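import Mathlib
import HarnessLib

/-! # `Balaban1983to89.B13Contraction113` — [Balaban1988RG2Cluster] p. 5 «We prove similarly that it is contractive», by reference to Sect. C of [15]

CITATION HEADER (lean-in-tree rule 2026-08-18).  T. Bałaban, *Renormalization group approach to lattice gauge field
theories. II. Cluster expansions*, Commun. Math. Phys. **116**, 1–22 (1988) [Balaban1988RG2Cluster] (cell paper B13;
held `paper:balaban1988-cmp116-rg-ii-cluster`, journal page = PDF page), Sect. 1 pp. 5–6, render-checked 2026-08-18
on `b2b-balaban-ref1/pages/1988-cmp116-rg-II-cluster/1988-cmp116-rg-II-cluster-p005-x2.png`, `…-p006-x2.png` (read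
as images); and the paper it cites as [15]: T. Bałaban, *The variational problem and background fields in
renormalization group method for lattice gauge theories*, Commun. Math. Phys. **102**, 277–309 (1985)
[Balaban1985Variational] (cell paper B11), Sect. C p. 286 [PDF 10] (53)–(55), (57) and p. 287 [PDF 11], renders
`b2b-balaban-ref1/pages/1985-cmp102-variational-background/1985-cmp102-variational-background-p010-x2.png`,
`…-p011-x2.png` (read as images).  Both papers are UNDER ADJUDICATION by the audit cell `pub-balaban`: nothing of
them is asserted.  The printed analytic inputs — the quadratic bound |C(Y)| ≦ C₂|Y|² of [15] p. 285 (from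
Proposition 4 / 7 of [4] = B7), the analyticity of C, the norm bound ‖H(s(Y₀))‖ ≤ B₀e^{16κ₁} of (1.11), the bound
(98) of Proposition 4 [15] — enter as HYPOTHESES over abstract complex normed spaces (`QuadAnalytic`, `hHop`, `han`),
and what is proved is proved by the kernel from Mathlib (Cauchy's estimate `Complex.norm_deriv_le_of_forall_mem_
sphere_norm_le`, the mean-value inequality `norm_image_sub_le_of_norm_deriv_le_segment_01'`, the contraction mapping
theorem `ContractingWith.exists_fixedPoint'`, `TendstoLocallyUniformlyOn.differentiableOn`).  NEW sibling of
`B13.lean`, `B13Sect1Arith.lean` (unit pv20-g2: the real ARITHMETIC of (1.13)–(1.22), cell GAPS C-pv20-5 — not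
repeated here; `selfmap_113`, `two_eps2_114`, `chain_115`, `chain_116` there), `B13PerturbativeStep.lean`; imports
Mathlib and HarnessLib only and modifies nothing.  Unit `b2b-balaban-b13-g5` (planner seat, gen 5 of the B13
lineage); cell records GAPS G-B13-02 (the objection this file answers), C-B13-02 (this certificate), G-B13-02a (the
located imprecision below), DIVERGENCE D-b13.14.

WHAT IS PRINTED (p. 5 [PDF 5], verbatim from the render).  *"Consider the change of variables A = A′ − H(s(Y₀))
D(H(s(Y₀)), A′). (1.12) The function D is the solution of Eq. (1.3) with H(s(Y₀)) instead of H. Let us introduce an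
auxiliary constant ε₂, and consider this equation on the space of functions satisfying |A′| < ε₂. Let us recall the
most important points from the discussion of Sect. C [15]. If we replace the function D in (1.3) by a configuration
X, then for the complex s(Y₀), |C(A′ − H(s(Y₀))X)| ≦ 2C₂ε₂² + 2C₂B₀²e^{32κ₁}|X|², (1.13) and for X satisfying |X| <
4C₂ε₂² ≦ (4C₂B₀²e^{32κ₁})⁻¹, hence for ε₂ satisfying 4C₂B₀e^{16κ₁}ε₂ ≦ 1, the right-hand side above is bounded by
4C₂ε₂². Thus the transformation defined by the function on the left-hand side of (1.13) maps the domain {X : |X| <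
4C₂ε₂²} into itself. We prove similarly that it is contractive on this domain, hence the fixed point is an analytic
function of A′, s(Y₀), bounded by 4C₂ε₂². Because ε₂ can be chosen arbitrarily close to |A′|, so we have the
inequality |D(H(s(Y₀)), A′)| ≦ 4C₂|A′|². (1.14) It is the same as the inequality (55) [15]. Similarly the other
inequalities and statements of Sect. C [15] hold in this case, for example the transformation (1.12) can be bounded
as in (57) [15]: |A| < ε₂ + B₀e^{16κ₁}4C₂ε₂² ≦ 2ε₂."*  And [15] p. 286 [PDF 10], the "similar" proof, verbatim: *"We
prove that the transformation (50) is contractive on this set, for ε₃ sufficiently small. We have for X₁, X₂ from the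
set C_j(L^jηA′ − L^jηHX₁) − C_j(L^jηA′ − L^jηHX₂) = ∫₀¹dt (d/dt)C_j(L^jηA′ − L^jηH(tX₁ + (1 − t)X₂)) = −∫₀¹dt
⟨(δC_j/δA)(L^jηA′ − L^jηH(tX₁ + (1 − t)X₂)), L^jηH(X₁ − X₂)⟩ = −∫₀¹dt (1/2πi)∫_{|τ|=r} dτ τ⁻² C_j(L^jηA′ −
L^jηH(tX₁ + (1 − t)X₂) + τL^jηH(X₁ − X₂)). (53) Taking r = ε₃(B₀|X₁ − X₂|)⁻¹, we get |C_j(L^jηA′ − L^jηHX₁) −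
C_j(L^jηA′ − L^jηHX₂)| ≦ (1/r)C₂(2ε₃ + rB₀|X₁ − X₂|)² = 9C₂B₀ε₃|X₁ − X₂|. (54) Hence the transformation is
contractive if 9C₂B₀ε₃ < 1; for example we take 9C₂B₀ε₃ ≦ 1/2, i.e. ε₃ ≦ (18C₂B₀)⁻¹. The contraction maping [sic]
theorem implies that for arbitrary A′, satisfying L^jη|A′| < ε₃ on Ω_j, there exists exactly one fixed point of the
transformation (50), thus exactly one solution of Eq. (49). This solution is a limit of uniformly convergent
sequence of successive approximations and it is an analytic function of A′. It satisfies the bound |D(A′)| < ε₃/B₀,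
but ε₃ was arbitrary, so we can take it arbitrarily close to sup_j L^jη sup_{Ω_j}|A′| = |A′|_{(−1)}, and we get the
bound |D(A′)| ≦ B₀⁻¹|A′|_{(−1)}. From Eq. (49) we obtain |D(A′)| = |C_j(L^jηA′ − L^jηHD(A′))| ≦ C₂(L^jη|A′| +
B₀|D(A′)|)² ≦ 4C₂|A′|²_{(−1)}. (55)"*; p. 287 [PDF 11]: *"A second remark concerns regularity properties of D(A′).
We know that it is an analytic function of A′ for gᶜ valued configurations A′ satisfying |A′|_{(−1)} < ε₃. It is a
function of the configuration U₀ also, and it is easy to see that it is an analytic function of U₀, because the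
averaging operations Q_j(U₀, ηA) and the operator H(U₀) are analytic in U₀."*

THE BY-REFERENCE CHECK (cell GAPS G-B13-02 → C-B13-02).  The Sect. C [15] argument uses the operator H only through
(i) linearity, (ii) a norm bound ‖HX‖ ≤ B₀|X| "in all norms", (iii) analyticity in the parameters; B13 p. 5 supplies
exactly (ii) and (iii) for H(s(Y₀)) with B₀ replaced by b := B₀e^{16κ₁} (display (1.11) and the sentence *"Thus the
function H(s(Y₀))X is an analytic function of the variables s(Y₀) on the domain |s(Y₀)| ≦ e^{κ₁}, bounded by
B₀e^{16κ₁}|X| in all norms of Theorems 3.1–3.10 [13]"*), and the functional C of (1.3) does not involve H at all —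
[15]'s Proposition 4 is itself stated for *"configurations A′ with values in the complexified Lie algebra gᶜ"*
(p. 292).  So the transfer "Sect. C [15] with (B₀, ε₃) ↦ (B₀e^{16κ₁}, ε₂)" is legitimate as a SCHEME; this file
kernel-checks the scheme over abstract complex normed spaces: Part A the Cauchy step of (53)–(54) (‖h(1) − h(0)‖ ≤
M/r for h holomorphic near the discs of radius r around [0, 1] and bounded by M on their circles — Cauchy's
estimate for the derivative, no factor 2, no completeness, then the mean-value inequality on [0, 1]); Part B the
transformation X ↦ C(A′ − HX): the printed (1.13) (`bound_113`), the self-map of the CLOSED ball 4C₂ε² under R2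
(`mapsTo_T`; argument norm < 2ε ≤ R), the transplanted Lipschitz bound 9C₂bε‖X₁ − X₂‖ (`lipschitz_T`, r =
ε(b‖X₁ − X₂‖)⁻¹, argument norm < 3ε ≤ R on the discs — (54) of [15] with (B₀, ε₃) ↦ (b, ε) LITERALLY), existence
and uniqueness of the fixed point in the closed ball under 9C₂bε < 1 (`exists_unique_fixedPoint`, Banach on the
complete subset), and (1.14) = (55) [15] by the printed "ε₂ arbitrarily close to |A′|" argument made honest
(`bound_114`: nested balls + uniqueness in the larger one, then ε′ ↓ |A′|); Part C the sentence *"hence the fixed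
point is an analytic function of A′, s(Y₀)"* / [15] *"a limit of uniformly convergent sequence of successive
approximations and it is an analytic function"* as a theorem, one complex parameter at a time
(`differentiableOn_fixedPoint`: uniformly contracting family preserving analytic families ⇒ successive
approximations holomorphic, uniformly convergent at rate 2ρqⁿ(1 − q)⁻¹, limit holomorphic); Part D the two fixed
points of B13 Sect. 1 as instances — (1.13)/(1.14) with the parameter (`analytic_fixedPoint_113`) and Eq. (1.4) /
(1.15)–(1.16) (`fixedPoint_115`: with W := G̃(δV/δA′)(H, ·) of quadratic constant C₄b and A₁ := H₀B′, Part B with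
(C₂, b, ε, H) ↦ (C₄b, 1, bε₃, −id) reproduces the printed radius 4C₄(B₀e^{16κ₁})³ε₃², the printed self-map
condition 4C₄B₀²e^{32κ₁}ε₃ ≦ 1 and the printed (1.16) constant 4C₄(B₀e^{16κ₁})³|B′|² LITERALLY).

THE LOCATED IMPRECISION (cell GAPS G-B13-02a; minor, absorbed, recorded for the referee).  *"We prove similarly that
it is contractive on this domain"* is printed right after the restriction 4C₂B₀e^{16κ₁}ε₂ ≦ 1 (census R2), which
gives the SELF-MAP; the "similar" proof (53)–(54) gives the Lipschitz constant 9C₂B₀e^{16κ₁}ε₂, which R2 bounds only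
by 9/4 (`contraction_constant`), and even the optimal Cauchy radius cannot bring it below 4C₂b(ε₂ + b·4C₂ε₂²) ≥
4C₂bε₂, not < 1 under R2 alone.  Contractivity needs the analogue of [15]'s own extra condition *"for example we take
9C₂B₀ε₃ ≦ 1/2, i.e. ε₃ ≦ (18C₂B₀)⁻¹"* — here 18C₂B₀e^{16κ₁}ε₂ ≤ 1 (which implies R2) — and likewise 18C₄B₀²e^{32κ₁}ε₃
≤ 1 for the fixed point of Eq. (1.4) behind (1.15)–(1.16), where contraction is not mentioned at all.  Both are
absolute smallness conditions of exactly the type gathered on p. 7 (*"if e^{32κ₁}ε₁ is smaller than an absolute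
constant. This constant can be easily obtained by inspection of all the above conditions"*), compatible with R4
(2bε₃ ≤ ε₂) and ε₃ = C₁ε₁ — with ε₂ = 2bε₃ the two contraction conditions read 36C₂C₁b²ε₁ ≤ 1 and 18C₄C₁b²ε₁ ≤ 1, b² =
B₀²e^{32κ₁} (`inspection_121_contraction`; i.e. the absolute constant 1/(B₀²C₁max{8C₂, 4C₄}) of `B13Sect1Arith.
inspection_121` becomes 1/(B₀²C₁max{36C₂, 18C₄})); nothing downstream changes.  The claim is therefore CERTIFIED AS A SCHEME with
the contraction condition made explicit, NOT refuted.

NOT CERTIFIED HERE (hypotheses, by name): the quadratic bound and analyticity of C (B7 Prop. 4/7 for complex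
arguments — GAPS G-B7-05, G-B11-C1), the bound (1.11) ‖H(s(Y₀))‖ ≤ B₀e^{16κ₁} (B9 random-walk expansion — GAPS
G-B13-01/G-IF-10), (98) of Proposition 4 [15] for the s(Y₀)-dependent background (its proof in [15] is for the
background U₀ of (14); the dependence on a complex background is covered by [15] p. 287's analyticity remark only
for H(U₀), Q_j(U₀, ·)), the identification of the abstract norm with "all norms of Theorems 3.1–3.10 [13]" (one
abstract norm here; the printed max{|𝐀|, |∇𝐀|} is the norm of the abstract space in `fixedPoint_115`), joint
analyticity in the several parameters s(Δ), Δ ⊂ Y₀∖□̃⁴ (one complex parameter at a time is typed; separate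
analyticity + the uniform bounds give joint analyticity by Osgood/Hartogs — [folklore], not formalised), and the
arithmetic chains of (1.13)–(1.22) (kernel: `B13Sect1Arith`).  MODELLING CONVENTIONS (DIVERGENCE D-b13.14): fields
X, A′, 𝐀 live in abstract complex normed spaces (complete where a fixed point is produced); H is a ℂ-linear map with
‖HX‖ ≤ b‖X‖; "analytic" = `DifferentiableOn ℂ` along complex lines / in one complex parameter on an open set; the
printed open ball {|X| < 4C₂ε₂²} is replaced by the closed ball (the complete set; the printed strict self-map
follows from |A′| < ε₂); the contraction condition is the hypothesis 9C₂bε < 1.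
-/

open Metric Set Filter Topology

namespace Literature.MathematicalPhysics.QuantumFieldTheory.Balaban1983to89.B13Contraction113

/-! ## Part A. The Cauchy step along a segment ((53)–(54) of [15]) -/

section cauchyStep

variable {E : Type*} [NormedAddCommGroup E] [NormedSpace ℂ E]

/-- Vector-valued `HasDerivAt.comp_ofReal` (Mathlib states it for `ℂ → ℂ`). [folklore] -/
theorem hasDerivAt_comp_ofReal {h : ℂ → E} {e : E} {t : ℝ} (hf : HasDerivAt h e (t : ℂ)) :
    HasDerivAt (fun y : ℝ => h (y : ℂ)) e t := by
  have h1 := ((hf.hasFDerivAt.restrictScalars ℝ).comp t Complex.ofRealCLM.hasFDerivAt).hasDerivAt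
  have h2 : HasDerivAt (h ∘ Complex.ofReal) e t := h1.congr_deriv (by simp)
  exact h2

/-- **The Cauchy step of (53)–(54) [15], abstract form.**  If `h` is complex-differentiable on an
open set `U ⊆ ℂ` containing the closed discs of radius `r > 0` around every point of the real
segment `[0, 1]`, and `‖h‖ ≤ M` on the corresponding circles, then `‖h 1 − h 0‖ ≤ M / r`:
the derivative along the segment is given by Cauchy's formula on the circle of radius `r`
(Mathlib's Cauchy estimate `Complex.norm_deriv_le_of_forall_mem_sphere_norm_le`, no factor 2 and
no completeness needed) and the real mean-value inequality integrates it over `[0, 1]` — exactly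
the two displayed lines of (53) p. 286 of [15]. [folklore] -/
theorem norm_sub_le_of_sphere_bound {h : ℂ → E} {U : Set ℂ} (hU : IsOpen U)
    (hd : DifferentiableOn ℂ h U) {r M : ℝ} (hr : 0 < r)
    (hsub : ∀ t : ℝ, t ∈ Icc (0:ℝ) 1 → closedBall (t : ℂ) r ⊆ U)
    (hM : ∀ t : ℝ, t ∈ Icc (0:ℝ) 1 → ∀ z ∈ sphere (t : ℂ) r, ‖h z‖ ≤ M) :
    ‖h 1 - h 0‖ ≤ M / r := by
  have key : ∀ t ∈ Icc (0:ℝ) 1,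
      HasDerivWithinAt (fun y : ℝ => h (y : ℂ)) (deriv h (t : ℂ)) (Icc (0:ℝ) 1) t := by
    intro t ht
    have hmem : (t : ℂ) ∈ U := hsub t ht (mem_closedBall_self hr.le)
    have hda : DifferentiableAt ℂ h (t : ℂ) := hd.differentiableAt (hU.mem_nhds hmem)
    exact (hasDerivAt_comp_ofReal hda.hasDerivAt).hasDerivWithinAt
  have bound : ∀ t ∈ Ico (0:ℝ) 1, ‖deriv h (t : ℂ)‖ ≤ M / r := by
    intro t ht
    have ht' : t ∈ Icc (0:ℝ) 1 := Ico_subset_Icc_self ht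
    exact Complex.norm_deriv_le_of_forall_mem_sphere_norm_le hr
      (hd.diffContOnCl_ball (hsub t ht')) (hM t ht')
  have h01 := norm_image_sub_le_of_norm_deriv_le_segment_01' key bound
  simpa using h01

end cauchyStep

/-! ## Part B. The transformation X ↦ C(A′ − H X) of (1.13) -/

section transformation

variable {𝒳 𝒴 : Type*} [NormedAddCommGroup 𝒳] [NormedSpace ℂ 𝒳] [NormedAddCommGroup 𝒴] [NormedSpace ℂ 𝒴]

/-- The two properties of the functional `C` of Eq. (1.3) (= `C_j` of (49) [15]) that the
Sect. C [15] argument consumes, over an abstract complex normed space of configurations, on the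
ball of radius `R`: the quadratic bound `‖C(Y)‖ ≤ C₂‖Y‖²` ([15] p. 285 *"|C_j(…)| ≦ C₂(…)²"* from
Proposition 4 of [4] = B7, complex form Proposition 7 — cell GAPS G-B11-C1 / G-B7-05) and
analyticity along complex lines (what the Cauchy formula (53) [15] consumes).  A HYPOTHESIS
structure: nothing printed is asserted. [cite: Balaban1985Variational, (49)-(55) pp.285-286] -/
structure QuadAnalytic (C : 𝒴 → 𝒳) (C₂ R : ℝ) : Prop where
  quad : ∀ Y : 𝒴, ‖Y‖ < R → ‖C Y‖ ≤ C₂ * ‖Y‖ ^ 2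
  lineAnalytic : ∀ P Q : 𝒴, DifferentiableOn ℂ (fun ζ : ℂ => C (P + ζ • Q)) {ζ | ‖P + ζ • Q‖ < R}

variable {C : 𝒴 → 𝒳} {C₂ R b ε : ℝ} {Hop : 𝒳 →ₗ[ℂ] 𝒴} {A' : 𝒴}

/-- On the ball `‖X‖ ≤ 4C₂ε²`, under R2 `4C₂bε ≤ 1`: `‖H X‖ ≤ b·4C₂ε² ≤ ε` (p. 5: *"|X| < 4C₂ε₂²
≦ (4C₂B₀²e^{32κ₁})⁻¹"*).  Real arithmetic. [cite: Balaban1988RG2Cluster, p.5 after (1.13)] -/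
theorem norm_Hop_le (hb : 0 ≤ b) (hε : 0 ≤ ε) (hHop : ∀ X, ‖Hop X‖ ≤ b * ‖X‖)
    (hR2 : 4 * C₂ * b * ε ≤ 1) {X : 𝒳} (hX : X ∈ closedBall (0:𝒳) (4 * C₂ * ε ^ 2)) :
    ‖Hop X‖ ≤ ε := by
  rw [mem_closedBall, dist_zero_right] at hX
  calc ‖Hop X‖ ≤ b * ‖X‖ := hHop X
    _ ≤ b * (4 * C₂ * ε ^ 2) := mul_le_mul_of_nonneg_left hX hb
    _ = (4 * C₂ * b * ε) * ε := by ring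
    _ ≤ 1 * ε := mul_le_mul_of_nonneg_right hR2 hε
    _ = ε := one_mul ε

/-- **(1.13) as printed**: *"If we replace the function D in (1.3) by a configuration X, then for
the complex s(Y₀), |C(A′ − H(s(Y₀))X)| ≦ 2C₂ε₂² + 2C₂B₀²e^{32κ₁}|X|²"* (p. 5), for `|A′| < ε₂`,
`‖H‖ ≤ b = B₀e^{16κ₁}`, whenever the argument lies in the ball where the quadratic bound holds.
[cite: Balaban1988RG2Cluster, (1.13) p.5] -/
theorem bound_113 (hC : QuadAnalytic C C₂ R) (hC₂ : 0 ≤ C₂)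
    (hHop : ∀ X, ‖Hop X‖ ≤ b * ‖X‖) (hA : ‖A'‖ < ε) {X : 𝒳} (harg : ‖A' - Hop X‖ < R) :
    ‖C (A' - Hop X)‖ ≤ 2 * C₂ * ε ^ 2 + 2 * C₂ * b ^ 2 * ‖X‖ ^ 2 := by
  have h1 := hC.quad _ harg
  have h2 : ‖A' - Hop X‖ ≤ ‖A'‖ + b * ‖X‖ := (norm_sub_le _ _).trans (add_le_add le_rfl (hHop X))
  have h3 : ‖A' - Hop X‖ ^ 2 ≤ (‖A'‖ + b * ‖X‖) ^ 2 := by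
    exact pow_le_pow_left₀ (norm_nonneg _) h2 2
  have h4 : (‖A'‖ + b * ‖X‖) ^ 2 ≤ 2 * ‖A'‖ ^ 2 + 2 * (b * ‖X‖) ^ 2 := by
    nlinarith [sq_nonneg (‖A'‖ - b * ‖X‖)]
  have h5 : ‖A'‖ ^ 2 ≤ ε ^ 2 := pow_le_pow_left₀ (norm_nonneg _) hA.le 2
  calc ‖C (A' - Hop X)‖ ≤ C₂ * ‖A' - Hop X‖ ^ 2 := h1
    _ ≤ C₂ * (2 * ‖A'‖ ^ 2 + 2 * (b * ‖X‖) ^ 2) := mul_le_mul_of_nonneg_left (h3.trans h4) hC₂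
    _ ≤ C₂ * (2 * ε ^ 2 + 2 * (b * ‖X‖) ^ 2) := by gcongr
    _ = 2 * C₂ * ε ^ 2 + 2 * C₂ * b ^ 2 * ‖X‖ ^ 2 := by ring

/-- **Self-mapping (p. 5)**: *"and for X satisfying |X| < 4C₂ε₂² ≦ (4C₂B₀²e^{32κ₁})⁻¹, hence
for ε₂ satisfying 4C₂B₀e^{16κ₁}ε₂ ≦ 1, the right-hand side above is bounded by 4C₂ε₂². Thus the
transformation defined by the function on the left-hand side of (1.13) maps the domain
{X : |X| < 4C₂ε₂²} into itself."*  Typed on the CLOSED ball (the complete set on which the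
contraction mapping theorem is applied below); the argument `A′ − H X` has norm `< 2ε ≤ R`.
(Arithmetic also in `B13Sect1Arith.selfmap_113`.) [cite: Balaban1988RG2Cluster, p.5 after (1.13)] -/
theorem mapsTo_T (hC : QuadAnalytic C C₂ R) (hC₂ : 0 ≤ C₂) (hb : 0 ≤ b)
    (hHop : ∀ X, ‖Hop X‖ ≤ b * ‖X‖) (hA : ‖A'‖ < ε) (hR2 : 4 * C₂ * b * ε ≤ 1) (hRC : 2 * ε ≤ R) :
    MapsTo (fun X => C (A' - Hop X)) (closedBall (0:𝒳) (4 * C₂ * ε ^ 2))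
      (closedBall (0:𝒳) (4 * C₂ * ε ^ 2)) := by
  intro X hX
  have hε : 0 ≤ ε := (norm_nonneg _).trans hA.le
  have hH : ‖Hop X‖ ≤ ε := norm_Hop_le hb hε hHop hR2 hX
  have harg : ‖A' - Hop X‖ < 2 * ε := by
    calc ‖A' - Hop X‖ ≤ ‖A'‖ + ‖Hop X‖ := norm_sub_le _ _
      _ < ε + ε := add_lt_add_of_lt_of_le hA hH
      _ = 2 * ε := by ring
  have hargR : ‖A' - Hop X‖ < R := harg.trans_le hRC
  rw [mem_closedBall, dist_zero_right]
  calc ‖C (A' - Hop X)‖ ≤ C₂ * ‖A' - Hop X‖ ^ 2 := hC.quad _ hargR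
    _ ≤ C₂ * (2 * ε) ^ 2 := by
        exact mul_le_mul_of_nonneg_left (pow_le_pow_left₀ (norm_nonneg _) harg.le 2) hC₂
    _ = 4 * C₂ * ε ^ 2 := by ring

/-- **The contraction estimate — (53)–(54) of [15] transplanted to (1.13).**  B13 p. 5: *"We prove
similarly that it is contractive on this domain"*; the "similar" proof is [15] p. 286: *"We have
for X₁, X₂ from the set C_j(L^jηA′ − L^jηHX₁) − C_j(L^jηA′ − L^jηHX₂) = ∫₀¹dt (d/dt)C_j(L^jηA′ −
L^jηH(tX₁ + (1 − t)X₂)) = … = −∫₀¹dt (1/2πi)∫_{|τ|=r} dτ τ⁻² C_j(L^jηA′ − L^jηH(tX₁ + (1 − t)X₂) +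
τL^jηH(X₁ − X₂)). (53) Taking r = ε₃(B₀|X₁ − X₂|)⁻¹, we get |C_j(…X₁) − C_j(…X₂)| ≦ (1/r)C₂(2ε₃ +
rB₀|X₁ − X₂|)² = 9C₂B₀ε₃|X₁ − X₂|. (54)"*.  Here, with `|A′| < ε`, `‖H‖ ≤ b`, `X₁, X₂` in the
closed ball `4C₂ε²`, R2 and `3ε ≤ R`: the argument stays in the ball of radius `3ε` on the discs
of radius `r = ε(b‖X₁ − X₂‖)⁻¹` around the segment, so the Lipschitz constant is `9C₂bε`.
[cite: Balaban1985Variational, (53)-(54) p.286] [cite: Balaban1988RG2Cluster, p.5 after (1.13)] -/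
theorem lipschitz_T (hC : QuadAnalytic C C₂ R) (hC₂ : 0 ≤ C₂) (hb : 0 ≤ b)
    (hHop : ∀ X, ‖Hop X‖ ≤ b * ‖X‖) (hA : ‖A'‖ < ε) (hR2 : 4 * C₂ * b * ε ≤ 1) (hRC : 3 * ε ≤ R)
    {X₁ X₂ : 𝒳} (h₁ : X₁ ∈ closedBall (0:𝒳) (4 * C₂ * ε ^ 2))
    (h₂ : X₂ ∈ closedBall (0:𝒳) (4 * C₂ * ε ^ 2)) :
    ‖C (A' - Hop X₁) - C (A' - Hop X₂)‖ ≤ 9 * C₂ * b * ε * ‖X₁ - X₂‖ := by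
  have hε : 0 < ε := (norm_nonneg _).trans_lt hA
  set δ : 𝒳 := X₁ - X₂ with hδ
  set P : 𝒴 := A' - Hop X₂ with hP
  set Q : 𝒴 := -(Hop δ) with hQ
  set h : ℂ → 𝒳 := fun ζ => C (P + ζ • Q) with hh
  have hQn : ‖Q‖ ≤ b * ‖δ‖ := by rw [hQ, norm_neg]; exact hHop δ
  have h0 : h 0 = C (A' - Hop X₂) := by simp [hh, hP]
  have h1 : h 1 = C (A' - Hop X₁) := by
    simp only [hh, hP, hQ, hδ, one_smul, map_sub]
    congr 1
    abel
  by_cases hbδ : b * ‖δ‖ = 0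
  · -- then Q = 0 and the two values coincide
    have hQ0 : Q = 0 := by
      have : ‖Q‖ ≤ 0 := hQn.trans hbδ.le
      exact norm_le_zero_iff.mp this
    have : h 1 = h 0 := by simp [hh, hQ0]
    rw [← h1, ← h0, this, sub_self, norm_zero]
    positivity
  have hbδpos : 0 < b * ‖δ‖ := lt_of_le_of_ne (mul_nonneg hb (norm_nonneg _)) (Ne.symm hbδ)
  set r : ℝ := ε / (b * ‖δ‖) with hr
  have hrpos : 0 < r := div_pos hε hbδpos
  have hrQ : r * ‖Q‖ ≤ ε := by
    calc r * ‖Q‖ ≤ r * (b * ‖δ‖) := mul_le_mul_of_nonneg_left hQn hrpos.le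
      _ = ε := by rw [hr, div_mul_cancel₀ _ (ne_of_gt hbδpos)]
  -- the segment points X_t lie in the closed ball
  have hXt : ∀ t : ℝ, t ∈ Icc (0:ℝ) 1 → ‖X₂ + (t : ℂ) • δ‖ ≤ 4 * C₂ * ε ^ 2 := by
    intro t ht
    have hconv := (convex_closedBall (0:𝒳) (4 * C₂ * ε ^ 2)) h₂ h₁ (sub_nonneg.mpr ht.2) ht.1
      (by ring)
    have heq : (1 - t) • X₂ + t • X₁ = X₂ + (t : ℂ) • δ := by
      rw [hδ, Complex.coe_smul, smul_sub, sub_smul, one_smul]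
      abel
    rw [heq, mem_closedBall, dist_zero_right] at hconv
    exact hconv
  -- norm of the argument on the discs around the segment: < 3ε
  have harg : ∀ t : ℝ, t ∈ Icc (0:ℝ) 1 → ∀ z ∈ closedBall (t : ℂ) r, ‖P + z • Q‖ < 3 * ε := by
    intro t ht z hz
    rw [mem_closedBall, dist_eq_norm] at hz
    have hsplit : P + z • Q = (A' - Hop (X₂ + (t : ℂ) • δ)) + (z - t) • Q := by
      rw [hP, hQ, map_add, map_smul, sub_smul, smul_neg, smul_neg]
      abel
    have hHt : ‖Hop (X₂ + (t : ℂ) • δ)‖ ≤ ε := by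
      refine norm_Hop_le hb hε.le hHop hR2 ?_
      rw [mem_closedBall, dist_zero_right]; exact hXt t ht
    calc ‖P + z • Q‖ = ‖(A' - Hop (X₂ + (t : ℂ) • δ)) + (z - t) • Q‖ := by rw [hsplit]
      _ ≤ ‖A' - Hop (X₂ + (t : ℂ) • δ)‖ + ‖(z - t) • Q‖ := norm_add_le _ _
      _ ≤ (‖A'‖ + ‖Hop (X₂ + (t : ℂ) • δ)‖) + ‖z - (t:ℂ)‖ * ‖Q‖ := by
          rw [norm_smul]; exact add_le_add (norm_sub_le _ _) le_rfl
      _ ≤ (‖A'‖ + ε) + r * ‖Q‖ := by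
          gcongr
      _ < (ε + ε) + ε := by linarith
      _ = 3 * ε := by ring
  have hU : IsOpen {ζ : ℂ | ‖P + ζ • Q‖ < R} :=
    isOpen_lt (continuous_const.add (continuous_id.smul continuous_const)).norm continuous_const
  have hsub : ∀ t : ℝ, t ∈ Icc (0:ℝ) 1 → closedBall (t : ℂ) r ⊆ {ζ : ℂ | ‖P + ζ • Q‖ < R} :=
    fun t ht z hz => (harg t ht z hz).trans_le hRC
  have hM : ∀ t : ℝ, t ∈ Icc (0:ℝ) 1 → ∀ z ∈ sphere (t : ℂ) r, ‖h z‖ ≤ C₂ * (3 * ε) ^ 2 := by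
    intro t ht z hz
    have hz' : z ∈ closedBall (t:ℂ) r := sphere_subset_closedBall hz
    have hlt := harg t ht z hz'
    calc ‖h z‖ = ‖C (P + z • Q)‖ := rfl
      _ ≤ C₂ * ‖P + z • Q‖ ^ 2 := hC.quad _ (hlt.trans_le hRC)
      _ ≤ C₂ * (3 * ε) ^ 2 :=
          mul_le_mul_of_nonneg_left (pow_le_pow_left₀ (norm_nonneg _) hlt.le 2) hC₂
  have main : ‖h 1 - h 0‖ ≤ C₂ * (3 * ε) ^ 2 / r :=
    norm_sub_le_of_sphere_bound hU (hC.lineAnalytic P Q) hrpos hsub hM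
  rw [h1, h0] at main
  calc ‖C (A' - Hop X₁) - C (A' - Hop X₂)‖ ≤ C₂ * (3 * ε) ^ 2 / r := main
    _ = 9 * C₂ * b * ε * ‖δ‖ := by
        rw [hr]
        field_simp
        ring

/-- **The located imprecision (cell GAPS G-B13-02a).**  The printed restriction R2
`4C₂B₀e^{16κ₁}ε₂ ≦ 1` gives self-mapping but, through the "similar" proof (53)–(54) of [15], only
the Lipschitz constant `9C₂bε₂ ≤ 9/4`; contractivity needs the ANALOGUE of [15]'s *"Hence the
transformation is contractive if 9C₂B₀ε₃ < 1; for example we take 9C₂B₀ε₃ ≦ 1/2, i.e. ε₃ ≦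
(18C₂B₀)⁻¹"* (p. 286), i.e. `18C₂bε₂ ≤ 1`, an extra absolute smallness condition of the type
absorbed by p. 7's *"if e^{32κ₁}ε₁ is smaller than an absolute constant"*.  Real arithmetic.
[cite: Balaban1985Variational, p.286 after (54)] -/
theorem contraction_constant (C₂ b ε : ℝ) :
    (4 * C₂ * b * ε ≤ 1 → 9 * C₂ * b * ε ≤ 9 / 4) ∧
    (18 * C₂ * b * ε ≤ 1 → 9 * C₂ * b * ε ≤ 1 / 2) ∧
    (18 * C₂ * b * ε ≤ 1 → 4 * C₂ * b * ε ≤ 1) := by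
  refine ⟨fun h => by nlinarith, fun h => by nlinarith, fun h => by nlinarith⟩

/-- **The fixed point (p. 5): existence and uniqueness in the closed ball `4C₂ε²`.**  *"We prove
similarly that it is contractive on this domain, hence the fixed point is an analytic function of
A′, s(Y₀), bounded by 4C₂ε₂²."* — the contraction mapping theorem (Mathlib
`ContractingWith.exists_fixedPoint'` on the complete subset `closedBall 0 (4C₂ε²)`) under the
contraction condition `9C₂bε < 1` (see `contraction_constant`) and `3ε ≤ R`.
[cite: Balaban1988RG2Cluster, p.5 after (1.13)] [cite: Balaban1985Variational, p.286] -/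
theorem exists_unique_fixedPoint [CompleteSpace 𝒳] (hC : QuadAnalytic C C₂ R) (hC₂ : 0 ≤ C₂)
    (hb : 0 ≤ b) (hHop : ∀ X, ‖Hop X‖ ≤ b * ‖X‖) (hA : ‖A'‖ < ε) (hq : 9 * C₂ * b * ε < 1)
    (hRC : 3 * ε ≤ R) :
    ∃ X ∈ closedBall (0:𝒳) (4 * C₂ * ε ^ 2), C (A' - Hop X) = X ∧
      ∀ X' ∈ closedBall (0:𝒳) (4 * C₂ * ε ^ 2), C (A' - Hop X') = X' → X' = X := by
  have hε : 0 < ε := (norm_nonneg _).trans_lt hA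
  have hK0 : 0 ≤ 9 * C₂ * b * ε := by positivity
  have hR2 : 4 * C₂ * b * ε ≤ 1 := by nlinarith
  have hRC2 : 2 * ε ≤ R := by linarith
  set s := closedBall (0:𝒳) (4 * C₂ * ε ^ 2) with hs
  have hmaps : MapsTo (fun X => C (A' - Hop X)) s s := mapsTo_T hC hC₂ hb hHop hA hR2 hRC2
  have hlip : ∀ X₁ ∈ s, ∀ X₂ ∈ s,
      ‖C (A' - Hop X₁) - C (A' - Hop X₂)‖ ≤ 9 * C₂ * b * ε * ‖X₁ - X₂‖ :=
    fun X₁ h₁ X₂ h₂ => lipschitz_T hC hC₂ hb hHop hA hR2 hRC h₁ h₂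
  set K : NNReal := ⟨9 * C₂ * b * ε, hK0⟩ with hK
  have hcontr : ContractingWith K (hmaps.restrict _ s s) := by
    refine ⟨?_, ?_⟩
    · change (⟨9 * C₂ * b * ε, hK0⟩ : NNReal) < 1
      exact_mod_cast hq
    · refine LipschitzWith.of_dist_le_mul fun x y => ?_
      change dist (C (A' - Hop (x:𝒳))) (C (A' - Hop (y:𝒳))) ≤ (9 * C₂ * b * ε) * dist (x:𝒳) (y:𝒳)
      rw [dist_eq_norm, dist_eq_norm]
      exact hlip _ x.2 _ y.2
  have hsc : IsComplete s := isClosed_closedBall.isComplete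
  have h0 : (0:𝒳) ∈ s := by simp [hs]; positivity
  obtain ⟨X, hXs, hfix, -, -⟩ :=
    ContractingWith.exists_fixedPoint' hsc hmaps hcontr h0 (edist_ne_top _ _)
  refine ⟨X, hXs, hfix, fun X' hX' hfix' => ?_⟩
  have h := hlip X' hX' X hXs
  rw [hfix', show C (A' - Hop X) = X from hfix] at h
  by_contra hne
  have hpos : 0 < ‖X' - X‖ := norm_pos_iff.mpr (sub_ne_zero.mpr hne)
  nlinarith

/-- **(1.14) (p. 5): the bound in terms of |A′|.**  *"Because ε₂ can be chosen arbitrarily close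
to |A′|, so we have the inequality |D(H(s(Y₀)), A′)| ≦ 4C₂|A′|². (1.14) It is the same as the
inequality (55) [15]."* — typed: the fixed point in the ball of an admissible radius `ε` lies in
the ball of every admissible radius `ε′ ∈ (|A′|, ε]` (existence there + uniqueness in the larger
ball), hence `‖X‖ ≤ 4C₂|A′|²` by letting `ε′ ↓ |A′|`. [cite: Balaban1988RG2Cluster, (1.14) p.5] -/
theorem bound_114 [CompleteSpace 𝒳] (hC : QuadAnalytic C C₂ R) (hC₂ : 0 ≤ C₂) (hb : 0 ≤ b)
    (hHop : ∀ X, ‖Hop X‖ ≤ b * ‖X‖) (hA : ‖A'‖ < ε) (hq : 9 * C₂ * b * ε < 1) (hRC : 3 * ε ≤ R)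
    {X : 𝒳} (hX : X ∈ closedBall (0:𝒳) (4 * C₂ * ε ^ 2)) (hfix : C (A' - Hop X) = X) :
    ‖X‖ ≤ 4 * C₂ * ‖A'‖ ^ 2 := by
  -- for every admissible ε' ∈ (‖A'‖, ε], ‖X‖ ≤ 4 C₂ ε'²
  have hstep : ∀ ε' ∈ Ioc ‖A'‖ ε, ‖X‖ ≤ 4 * C₂ * ε' ^ 2 := by
    intro ε' hε'
    have hε'0 : 0 ≤ ε' := (norm_nonneg _).trans hε'.1.le
    have hq' : 9 * C₂ * b * ε' < 1 :=
      lt_of_le_of_lt (by nlinarith [mul_nonneg (mul_nonneg (by norm_num : (0:ℝ) ≤ 9) hC₂) hb, hε'.2]) hq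
    have hRC' : 3 * ε' ≤ R := by linarith [hε'.2]
    obtain ⟨X₀, hX₀, hfix₀, -⟩ := exists_unique_fixedPoint hC hC₂ hb hHop hε'.1 hq' hRC'
    obtain ⟨-, -, -, huniq⟩ := exists_unique_fixedPoint hC hC₂ hb hHop hA hq hRC
    have hX₀' : X₀ ∈ closedBall (0:𝒳) (4 * C₂ * ε ^ 2) := by
      rw [mem_closedBall, dist_zero_right] at hX₀ ⊢
      exact hX₀.trans (mul_le_mul_of_nonneg_left (pow_le_pow_left₀ hε'0 hε'.2 2) (by positivity))
    -- both X and X₀ are fixed points in the ε-ball, hence equal to the unique one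
    obtain ⟨X₁, -, -, huniq₁⟩ := exists_unique_fixedPoint hC hC₂ hb hHop hA hq hRC
    have e1 : X = X₁ := huniq₁ X hX hfix
    have e2 : X₀ = X₁ := huniq₁ X₀ hX₀' hfix₀
    rw [e1, ← e2]
    rw [mem_closedBall, dist_zero_right] at hX₀
    exact hX₀
  -- let ε' ↓ ‖A'‖
  have hcont : Tendsto (fun ε' : ℝ => 4 * C₂ * ε' ^ 2) (𝓝[>] ‖A'‖) (𝓝 (4 * C₂ * ‖A'‖ ^ 2)) :=
    ((continuous_const.mul (continuous_pow 2)).tendsto _).mono_left nhdsWithin_le_nhds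
  refine ge_of_tendsto hcont ?_
  filter_upwards [Ioc_mem_nhdsGT hA] with ε' hε' using hstep ε' hε'

end transformation

/-! ## Part C. Analytic dependence of the fixed point on a complex parameter -/

section analytic

variable {𝒳 : Type*} [NormedAddCommGroup 𝒳] [NormedSpace ℂ 𝒳] [CompleteSpace 𝒳]

/-- **"hence the fixed point is an analytic function of A′, s(Y₀)" (p. 5) / [15] p. 286 "This
solution is a limit of uniformly convergent sequence of successive approximations and it is an
analytic function of A′."** — typed one complex parameter at a time: a family of maps `T σ`,
`σ ∈ V` open, each mapping the closed ball `‖X‖ ≤ ρ` into itself with a UNIFORM Lipschitz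
constant `q < 1` there, and preserving analytic families (`σ ↦ T σ (g σ)` is holomorphic on `V`
whenever `g` is holomorphic on `V` with values in the ball — the honest rendering of "C, H(s),
A′ are analytic"), has a fixed-point map `σ ↦ X⋆(σ)` holomorphic on `V`: the successive
approximations `(T σ)^[n] 0` are holomorphic, converge uniformly on `V` at the geometric rate
`2ρqⁿ(1 − q)⁻¹`, and a locally uniform limit of holomorphic maps is holomorphic (Mathlib
`TendstoLocallyUniformlyOn.differentiableOn`). [cite: Balaban1985Variational, p.286 after (54)]
[cite: Balaban1988RG2Cluster, p.5 after (1.13)] -/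
theorem differentiableOn_fixedPoint {T : ℂ → 𝒳 → 𝒳} {V : Set ℂ} (hV : IsOpen V) {ρ q : ℝ}
    (hρ : 0 ≤ ρ) (hq0 : 0 ≤ q) (hq : q < 1)
    (hmaps : ∀ σ ∈ V, MapsTo (T σ) (closedBall (0:𝒳) ρ) (closedBall (0:𝒳) ρ))
    (hlip : ∀ σ ∈ V, ∀ X ∈ closedBall (0:𝒳) ρ, ∀ X' ∈ closedBall (0:𝒳) ρ,
      ‖T σ X - T σ X'‖ ≤ q * ‖X - X'‖)
    (han : ∀ g : ℂ → 𝒳, DifferentiableOn ℂ g V → MapsTo g V (closedBall (0:𝒳) ρ) →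
      DifferentiableOn ℂ (fun σ => T σ (g σ)) V) :
    ∃ Xs : ℂ → 𝒳, DifferentiableOn ℂ Xs V ∧
      (∀ σ ∈ V, Xs σ ∈ closedBall (0:𝒳) ρ ∧ T σ (Xs σ) = Xs σ) ∧
      ∀ σ ∈ V, ∀ n : ℕ, dist ((T σ)^[n] 0) (Xs σ) ≤ 2 * ρ * q ^ n / (1 - q) := by
  -- successive approximations
  set iter : ℕ → ℂ → 𝒳 := fun n σ => (T σ)^[n] 0 with hiter
  have hmem : ∀ σ ∈ V, ∀ n, iter n σ ∈ closedBall (0:𝒳) ρ := by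
    intro σ hσ n
    have h0 : (0:𝒳) ∈ closedBall (0:𝒳) ρ := by simp [hρ]
    exact (hmaps σ hσ).iterate n h0
  have hsucc : ∀ n, iter (n + 1) = fun σ => T σ (iter n σ) := by
    intro n; funext σ; simp [hiter, Function.iterate_succ_apply']
  have hdiff : ∀ n, DifferentiableOn ℂ (iter n) V := by
    intro n
    induction n with
    | zero =>
      have : iter 0 = fun _ => (0:𝒳) := by funext σ; simp [hiter]
      rw [this]; exact differentiableOn_const 0
    | succ n ih =>
      rw [hsucc n]
      exact han (iter n) ih (fun σ hσ => hmem σ hσ n)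
  -- geometric decay of the increments
  have hgeom : ∀ σ ∈ V, ∀ n, dist (iter n σ) (iter (n + 1) σ) ≤ 2 * ρ * q ^ n := by
    intro σ hσ n
    induction n with
    | zero =>
      have h1 : iter 1 σ ∈ closedBall (0:𝒳) ρ := hmem σ hσ 1
      have h0 : iter 0 σ = 0 := by simp [hiter]
      rw [mem_closedBall] at h1
      rw [h0, pow_zero, mul_one, dist_comm]
      linarith [dist_nonneg (x := iter 1 σ) (y := (0:𝒳))]
    | succ n ih =>
      have e1 : iter (n + 1) σ = T σ (iter n σ) := by rw [hsucc n]
      have e2 : iter (n + 1 + 1) σ = T σ (iter (n + 1) σ) := by rw [hsucc (n + 1)]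
      rw [e2, e1, dist_eq_norm]
      calc ‖T σ (iter n σ) - T σ (T σ (iter n σ))‖ ≤ q * ‖iter n σ - T σ (iter n σ)‖ :=
            hlip σ hσ _ (hmem σ hσ n) _ (by rw [← e1]; exact hmem σ hσ (n + 1))
        _ = q * dist (iter n σ) (iter (n + 1) σ) := by rw [dist_eq_norm, e1]
        _ ≤ q * (2 * ρ * q ^ n) := mul_le_mul_of_nonneg_left ih hq0
        _ = 2 * ρ * q ^ (n + 1) := by ring
  -- pointwise limits
  set Xs : ℂ → 𝒳 := fun σ => limUnder atTop (fun n => iter n σ) with hXs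
  have htend : ∀ σ ∈ V, Tendsto (fun n => iter n σ) atTop (𝓝 (Xs σ)) := by
    intro σ hσ
    have hc : CauchySeq (fun n => iter n σ) := cauchySeq_of_le_geometric q (2 * ρ) hq (hgeom σ hσ)
    exact hc.tendsto_limUnder
  have hrate : ∀ σ ∈ V, ∀ n, dist (iter n σ) (Xs σ) ≤ 2 * ρ * q ^ n / (1 - q) :=
    fun σ hσ n => dist_le_of_le_geometric_of_tendsto q (2 * ρ) hq (hgeom σ hσ) (htend σ hσ) n
  -- uniform convergence on V
  have hunif : TendstoUniformlyOn iter Xs atTop V := by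
    rw [Metric.tendstoUniformlyOn_iff]
    intro e he
    have hlim : Tendsto (fun n : ℕ => 2 * ρ * q ^ n / (1 - q)) atTop (𝓝 0) := by
      have := ((tendsto_pow_atTop_nhds_zero_of_lt_one hq0 hq).const_mul (2 * ρ)).div_const (1 - q)
      simpa using this
    filter_upwards [(tendsto_order.1 hlim).2 e he] with n hn σ hσ
    rw [dist_comm]
    exact (hrate σ hσ n).trans_lt hn
  have hXdiff : DifferentiableOn ℂ Xs V :=
    hunif.tendstoLocallyUniformlyOn.differentiableOn (Eventually.of_forall hdiff) hV
  refine ⟨Xs, hXdiff, fun σ hσ => ⟨?_, ?_⟩, hrate⟩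
  · exact isClosed_closedBall.mem_of_tendsto (htend σ hσ) (Eventually.of_forall (hmem σ hσ))
  · -- T σ (Xs σ) = Xs σ : pass to the limit in iter (n+1) σ = T σ (iter n σ)
    have hXmem : Xs σ ∈ closedBall (0:𝒳) ρ :=
      isClosed_closedBall.mem_of_tendsto (htend σ hσ) (Eventually.of_forall (hmem σ hσ))
    have h1 : Tendsto (fun n => iter (n + 1) σ) atTop (𝓝 (Xs σ)) :=
      (htend σ hσ).comp (tendsto_add_atTop_nat 1)
    have h2 : Tendsto (fun n => iter (n + 1) σ) atTop (𝓝 (T σ (Xs σ))) := by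
      have h2' : ∀ n, iter (n + 1) σ = T σ (iter n σ) := fun n => by rw [hsucc n]
      simp_rw [h2']
      rw [tendsto_iff_norm_sub_tendsto_zero]
      have hbd : ∀ n, ‖T σ (iter n σ) - T σ (Xs σ)‖ ≤ q * ‖iter n σ - Xs σ‖ :=
        fun n => hlip σ hσ _ (hmem σ hσ n) _ hXmem
      have hlim0 : Tendsto (fun n => q * ‖iter n σ - Xs σ‖) atTop (𝓝 0) := by
        have := (tendsto_iff_norm_sub_tendsto_zero.1 (htend σ hσ)).const_mul q
        simpa using this
      exact squeeze_zero (fun n => norm_nonneg _) hbd hlim0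
    exact tendsto_nhds_unique h2 h1

end analytic

/-! ## Part D. The two fixed points of B13 Sect. 1 as instances -/

section instances

variable {𝒳 𝒴 : Type*} [NormedAddCommGroup 𝒳] [NormedSpace ℂ 𝒳] [NormedAddCommGroup 𝒴] [NormedSpace ℂ 𝒴]

/-- **The fixed point of (1.13) as an analytic function of one complex parameter** (p. 5 *"hence
the fixed point is an analytic function of A′, s(Y₀), bounded by 4C₂ε₂²"*): for a family
`σ ↦ (H_σ, A′_σ)`, `σ ∈ V` open, with `‖H_σ‖ ≤ b`, `|A′_σ| < ε` and the composite
`σ ↦ C(A′_σ − H_σ g(σ))` holomorphic for holomorphic ball-valued `g` (hypothesis `han`), under the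
contraction condition `9C₂bε < 1` and `3ε ≤ R`, Part C gives a holomorphic `σ ↦ X⋆(σ)` in the
closed ball `4C₂ε²` solving `C(A′_σ − H_σ X⋆(σ)) = X⋆(σ)`, and by Part B it is the unique
solution there and obeys (1.14). [cite: Balaban1988RG2Cluster, p.5 after (1.13)] -/
theorem analytic_fixedPoint_113 [CompleteSpace 𝒳] {C : 𝒴 → 𝒳} {C₂ R b ε : ℝ}
    (hC : QuadAnalytic C C₂ R) (hC₂ : 0 ≤ C₂) (hb : 0 ≤ b) {V : Set ℂ} (hV : IsOpen V)
    {Hσ : ℂ → (𝒳 →ₗ[ℂ] 𝒴)} {Aσ : ℂ → 𝒴} (hHop : ∀ σ ∈ V, ∀ X, ‖Hσ σ X‖ ≤ b * ‖X‖)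
    (hA : ∀ σ ∈ V, ‖Aσ σ‖ < ε) (hq : 9 * C₂ * b * ε < 1) (hRC : 3 * ε ≤ R)
    (han : ∀ g : ℂ → 𝒳, DifferentiableOn ℂ g V → MapsTo g V (closedBall (0:𝒳) (4 * C₂ * ε ^ 2)) →
      DifferentiableOn ℂ (fun σ => C (Aσ σ - Hσ σ (g σ))) V) :
    ∃ Xs : ℂ → 𝒳, DifferentiableOn ℂ Xs V ∧ ∀ σ ∈ V,
      Xs σ ∈ closedBall (0:𝒳) (4 * C₂ * ε ^ 2) ∧ C (Aσ σ - Hσ σ (Xs σ)) = Xs σ ∧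
      (∀ X' ∈ closedBall (0:𝒳) (4 * C₂ * ε ^ 2), C (Aσ σ - Hσ σ X') = X' → X' = Xs σ) ∧
      ‖Xs σ‖ ≤ 4 * C₂ * ‖Aσ σ‖ ^ 2 := by
  by_cases hVne : V.Nonempty
  swap
  · refine ⟨fun _ => 0, ?_, fun σ hσ => (hVne ⟨σ, hσ⟩).elim⟩
    rw [Set.not_nonempty_iff_eq_empty.mp hVne]; exact differentiableOn_empty
  obtain ⟨σ₀, hσ₀⟩ := hVne
  have hε : 0 < ε := (norm_nonneg _).trans_lt (hA σ₀ hσ₀)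
  have hq0 : 0 ≤ 9 * C₂ * b * ε := by positivity
  have hR2 : 4 * C₂ * b * ε ≤ 1 := by nlinarith
  have hRC2 : 2 * ε ≤ R := by linarith
  have hρ : 0 ≤ 4 * C₂ * ε ^ 2 := by positivity
  obtain ⟨Xs, hXd, hfix, -⟩ := differentiableOn_fixedPoint (T := fun σ X => C (Aσ σ - Hσ σ X))
    hV hρ hq0 hq (fun σ hσ => mapsTo_T hC hC₂ hb (hHop σ hσ) (hA σ hσ) hR2 hRC2)
    (fun σ hσ X hX X' hX' => lipschitz_T hC hC₂ hb (hHop σ hσ) (hA σ hσ) hR2 hRC hX hX') han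
  refine ⟨Xs, hXd, fun σ hσ => ⟨(hfix σ hσ).1, (hfix σ hσ).2, fun X' hX' hfix' => ?_, ?_⟩⟩
  · obtain ⟨X₁, -, -, huniq⟩ := exists_unique_fixedPoint hC hC₂ hb (hHop σ hσ) (hA σ hσ) hq hRC
    rw [huniq X' hX' hfix', huniq (Xs σ) (hfix σ hσ).1 (hfix σ hσ).2]
  · exact bound_114 hC hC₂ hb (hHop σ hσ) (hA σ hσ) hq hRC (hfix σ hσ).1 (hfix σ hσ).2

/-- **The second fixed point, Eq. (1.4) / (1.15)–(1.16) (p. 6), is the same scheme.**  Printed: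
*"|G̃(s(Y₀))((δ/δA′)V)(H(s(Y₀)), H₀(s(Y₀))B′ + 𝐀)| ≦ 2C₄(B₀e^{16κ₁})³|B′|² + 2C₄B₀e^{16κ₁}
(max{|𝐀|, |∇𝐀|})² < 2C₄(B₀e^{16κ₁})³ε₃² + ½max{|𝐀|, |∇𝐀|} < 4C₄(B₀e^{16κ₁})³ε₃², (1.15) if
max{|𝐀|, ∇𝐀|} < 4C₄(B₀e^{16κ₁})³ε₃² ≦ (4C₄B₀e^{16κ₁})⁻¹, and if |B′| < ε₃ … The last inequality
holds if 4C₄B₀²e^{32κ₁}ε₃ ≦ 1. … It implies that the fixed point, i.e. the solution of Eq. (1.4),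
is an analytic function of B′, s(Y₀) on the considered domains, it satisfies the bound |𝐀₀(s(Y₀),
H₀(s(Y₀))B′)| ≦ 4C₄(B₀e^{16κ₁})³|B′|² (1.16)"*.  With `W := G̃(δV/δA′)(H, ·)` (quadratic constant
`C₄b` from (98) [15] and `‖G̃‖ ≤ b`, on the ball of radius `R` of the max-norm space), `A₁ :=
H₀B′` (`‖A₁‖ < bε₃`), this is Part B with `(C₂, b, ε, H) ↦ (C₄b, 1, bε₃, −id)`: the radius
`4(C₄b)(bε₃)² = 4C₄b³ε₃²` and the self-map condition `4(C₄b)(bε₃) ≤ 1 ⇔ 4C₄b²ε₃ ≤ 1` are the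
printed ones LITERALLY, the (undisplayed) contraction condition is `9C₄b²ε₃ < 1`, and (1.16)'s
`4C₄b³|B′|²` is `bound_114` with `‖A₁‖ ≤ b|B′|`. [cite: Balaban1988RG2Cluster, (1.15)-(1.16) p.6] -/
theorem fixedPoint_115 [CompleteSpace 𝒴] {W : 𝒴 → 𝒴} {C₄ b R ε₃ nB : ℝ} {A₁ : 𝒴}
    (hW : QuadAnalytic W (C₄ * b) R) (hC₄ : 0 ≤ C₄) (hb : 0 < b)
    (hA₁ : ‖A₁‖ ≤ b * nB) (hB : nB < ε₃)
    (hq : 9 * C₄ * b ^ 2 * ε₃ < 1) (hRC : 3 * (b * ε₃) ≤ R) :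
    ∃ A ∈ closedBall (0:𝒴) (4 * C₄ * b ^ 3 * ε₃ ^ 2), W (A₁ + A) = A ∧
      (∀ A' ∈ closedBall (0:𝒴) (4 * C₄ * b ^ 3 * ε₃ ^ 2), W (A₁ + A') = A' → A' = A) ∧
      ‖A‖ ≤ 4 * C₄ * b ^ 3 * nB ^ 2 := by
  -- the instance of Part B: (C₂, b, ε, H) ↦ (C₄b, 1, bε₃, −id)
  set Hop : 𝒴 →ₗ[ℂ] 𝒴 := -LinearMap.id with hHopdef
  have hHop : ∀ X : 𝒴, ‖Hop X‖ ≤ 1 * ‖X‖ := fun X => by simp [hHopdef]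
  have hsub : ∀ X : 𝒴, A₁ - Hop X = A₁ + X := fun X => by simp [hHopdef]
  have hA : ‖A₁‖ < b * ε₃ := hA₁.trans_lt (mul_lt_mul_of_pos_left hB hb)
  have hC₂ : 0 ≤ C₄ * b := mul_nonneg hC₄ hb.le
  have hq' : 9 * (C₄ * b) * 1 * (b * ε₃) < 1 := by nlinarith
  have hrad : 4 * (C₄ * b) * (b * ε₃) ^ 2 = 4 * C₄ * b ^ 3 * ε₃ ^ 2 := by ring
  obtain ⟨A, hAmem, hfix, huniq⟩ :=
    exists_unique_fixedPoint hW hC₂ zero_le_one hHop hA hq' hRC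
  have hbd := bound_114 hW hC₂ zero_le_one hHop hA hq' hRC hAmem hfix
  rw [hrad] at hAmem huniq
  rw [hsub] at hfix
  refine ⟨A, hAmem, hfix, fun A' hA' hfix' => huniq A' hA' (by rw [hsub]; exact hfix'), ?_⟩
  calc ‖A‖ ≤ 4 * (C₄ * b) * ‖A₁‖ ^ 2 := hbd
    _ ≤ 4 * (C₄ * b) * (b * nB) ^ 2 := by
        exact mul_le_mul_of_nonneg_left (pow_le_pow_left₀ (norm_nonneg _) hA₁ 2) (by positivity)
    _ = 4 * C₄ * b ^ 3 * nB ^ 2 := by ring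


/-- **G-B13-02a absorbed by p. 7's "inspection"** (*"if e^{32κ₁}ε₁ is smaller than an absolute constant. This
constant can be easily obtained by inspection of all the above conditions"*): with ε₃ := C₁ε₁ and ε₂ := 2bε₃
(equality in R4, as in `B13Sect1Arith.inspection_121`), the two CONTRACTION conditions 18C₂bε₂ ≤ 1 (for (1.13))
and 18C₄b²ε₃ ≤ 1 (for Eq. (1.4)) hold as soon as b²ε₁·36C₂C₁ ≤ 1 and b²ε₁·18C₄C₁ ≤ 1, and they imply the printed
self-map conditions R2, R3.  Real arithmetic. [cite: Balaban1988RG2Cluster, (1.21) p.7] -/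
theorem inspection_121_contraction {b C₁ C₂ C₄ ε₁ : ℝ} (hC₂ : 0 ≤ C₂) (hC₄ : 0 ≤ C₄)
    (hε₁ : 0 ≤ C₁ * ε₁)
    (hA : b ^ 2 * ε₁ * (36 * C₂ * C₁) ≤ 1) (hB : b ^ 2 * ε₁ * (18 * C₄ * C₁) ≤ 1) :
    let ε₃ := C₁ * ε₁
    let ε₂ := 2 * b * ε₃
    (18 * C₂ * b * ε₂ ≤ 1 ∧ 18 * C₄ * b ^ 2 * ε₃ ≤ 1) ∧
      (4 * C₂ * b * ε₂ ≤ 1 ∧ 4 * C₄ * b ^ 2 * ε₃ ≤ 1 ∧ 2 * b * ε₃ ≤ ε₂) := by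
  intro ε₃ ε₂
  have e1 : 18 * C₂ * b * ε₂ = b ^ 2 * ε₁ * (36 * C₂ * C₁) := by simp only [ε₂, ε₃]; ring
  have e2 : 18 * C₄ * b ^ 2 * ε₃ = b ^ 2 * ε₁ * (18 * C₄ * C₁) := by simp only [ε₃]; ring
  have p1 : 0 ≤ C₂ * b * ε₂ := by
    have : C₂ * b * ε₂ = 2 * C₂ * b ^ 2 * (C₁ * ε₁) := by simp only [ε₂, ε₃]; ring
    rw [this]; positivity
  have p2 : 0 ≤ C₄ * b ^ 2 * ε₃ := by simp only [ε₃]; positivity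
  refine ⟨⟨by rw [e1]; exact hA, by rw [e2]; exact hB⟩, by nlinarith, by nlinarith, le_rfl⟩

end instances

end Literature.MathematicalPhysics.QuantumFieldTheory.Balaban1983to89.B13Contraction113
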